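import Summits.Parity.GeneralizedHardyLittlewood.Theses.GoldbachHeathBrownDispersion
import Literature.NumberTheory.Sieve.HeathBrownMorozClassFamily
import HarnessLib

/-!
# Crux `HeathBrownMorozUniform` (stmt-Parity-19915): the frame shift between the crux's count and the class count

Helper (`--supports stmt-Parity-19915`).  The crux counts pairs `(x₁, x₂) ∈ (X', X'(1+η)]²` with
`(a + dx₁)³ + 2(b + dx₂)³` prime (`CubicPrimes.residueClassPrimeCount`, quotient coordinates of HBM04); the
coset port works in Heath-Brown's frame with the class family `classPairs X η d a b` (`x ≡ a`, `y ≡ b (mod d)`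
inside the box `(X, X(1+η)]²`) at height `X = dX'`.  Substituting `x = a + dx₁` the two boxes differ by the REAL
shift `(a, b)`; this file proves the resulting comparison:

* `natCard_Ioc_real_le`, `mem_Ioc_floor_of`, `card_slab_le`, `card_box_shift_le` — lattice points under a
  real shift of a box (two slabs of widths `≤ s+1`, `≤ t+1` and length `≤ ηY+1`);
* **`abs_residueClassPrimeCount_sub_classPrimeCount_le`** —
  `|residueClassPrimeCount X' η d a b − classPrimeCount (dX') η d a b| ≤ (a + b + 2)(η·dX' + 1)`.

References: [cite: HeathBrownMoroz2004, §1 (1.1)–(1.2)]. Tree: `residueClassPrimePairs`,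
`mem_residueClassPrimePairs_iff`, `residueClassPrimeCount_def`, `classPairs`, `mem_classPairs_iff`,
`mem_boxPairs_iff`, `classPrimeCount_def`; Mathlib `Nat.floor_lt`, `Nat.le_floor`, `Nat.floor_add_natCast`,
`Nat.modEq_iff_dvd'`, `Finset.card_map`.
-/

noncomputable section

open Polynomial NumberField Finset Filter Topology Asymptotics

namespace Summit.Parity.GeneralizedHardyLittlewood.Theorems.GoldbachHeathBrownDispersionHeathBrownMorozUniform

open Literature.NumberTheory.Sieve.CubicSieve Literature.NumberTheory.Sieve.CubicPrimes
open Literature.NumberTheory.LFunctions.CubeRootTwoField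

/-! ### Lattice points under a real shift of a box -/

/-- The number of integers in `(α, β]` is `⌊β⌋₊ − ⌊α⌋₊ ≤ β − α + 1` (`0 ≤ α ≤ β`). [folklore] -/
theorem natCard_Ioc_real_le {α β : ℝ} (hα : 0 ≤ α) (hαβ : α ≤ β) :
    ((⌊β⌋₊ - ⌊α⌋₊ : ℕ) : ℝ) ≤ β - α + 1 := by
  have hmono : ⌊α⌋₊ ≤ ⌊β⌋₊ := Nat.floor_le_floor hαβ
  rw [Nat.cast_sub hmono]
  have h1 : (⌊β⌋₊ : ℝ) ≤ β := Nat.floor_le (hα.trans hαβ)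
  have h2 : α < ⌊α⌋₊ + 1 := Nat.lt_floor_add_one α
  linarith

/-- A natural number in the real interval `(α, β]` (`α ≥ 0`) lies in `Ioc ⌊α⌋₊ ⌊β⌋₊`. [folklore] -/
theorem mem_Ioc_floor_of {α β : ℝ} (hα : 0 ≤ α) {n : ℕ} (h1 : α < n) (h2 : (n : ℝ) ≤ β) :
    n ∈ Ioc ⌊α⌋₊ ⌊β⌋₊ :=
  mem_Ioc.2 ⟨(Nat.floor_lt hα).2 h1, Nat.le_floor h2⟩

/-- The slab count: `#(Ioc ⌊α⌋₊ ⌊β⌋₊ ×ˢ Ioc ⌊γ⌋₊ ⌊δ⌋₊) ≤ (β − α + 1)(δ − γ + 1)`. [folklore] -/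
theorem card_slab_le {α β γ δ : ℝ} (hα : 0 ≤ α) (hαβ : α ≤ β) (hγ : 0 ≤ γ) (hγδ : γ ≤ δ) :
    (#(Ioc ⌊α⌋₊ ⌊β⌋₊ ×ˢ Ioc ⌊γ⌋₊ ⌊δ⌋₊) : ℝ) ≤ (β - α + 1) * (δ - γ + 1) := by
  rw [card_product, Nat.card_Ioc, Nat.card_Ioc, Nat.cast_mul]
  exact mul_le_mul (natCard_Ioc_real_le hα hαβ) (natCard_Ioc_real_le hγ hγδ) (Nat.cast_nonneg _)
    (by linarith)

/-- **Real box-shift lemma.** For a property `P` of lattice points, the number of `P`-points in the box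
`(Y+s, Y(1+η)+s] × (Y+t, Y(1+η)+t]` and in `(Y, Y(1+η)]²` (`Y, η, s, t ≥ 0`; both counted inside any finite
universe `U`) differ by at most `(s + t + 2)(ηY + 1)`: both contain the `P`-points of the inner box
`(Y+s, Y(1+η)] × (Y+t, Y(1+η)]`, and the rest lies in two slabs of widths `≤ s+1`, `≤ t+1`. [folklore] -/
theorem card_box_shift_le (U : Finset (ℕ × ℕ)) (P : ℕ × ℕ → Prop) [DecidablePred P] {Y η s t : ℝ}
    (hY : 0 ≤ Y) (hη : 0 ≤ η) (hs : 0 ≤ s) (ht : 0 ≤ t) :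
    |(#(U.filter fun p => Y + s < p.1 ∧ (p.1 : ℝ) ≤ Y * (1 + η) + s ∧ Y + t < p.2 ∧
          (p.2 : ℝ) ≤ Y * (1 + η) + t ∧ P p) : ℝ) -
      #(U.filter fun p => Y < p.1 ∧ (p.1 : ℝ) ≤ Y * (1 + η) ∧ Y < p.2 ∧ (p.2 : ℝ) ≤ Y * (1 + η) ∧ P p)| ≤
      (s + t + 2) * (η * Y + 1) := by
  classical
  set S₁ := U.filter fun p => Y + s < p.1 ∧ (p.1 : ℝ) ≤ Y * (1 + η) + s ∧ Y + t < p.2 ∧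
    (p.2 : ℝ) ≤ Y * (1 + η) + t ∧ P p with hS₁
  set S₀ := U.filter fun p => Y < p.1 ∧ (p.1 : ℝ) ≤ Y * (1 + η) ∧ Y < p.2 ∧ (p.2 : ℝ) ≤ Y * (1 + η) ∧ P p
    with hS₀
  set I := U.filter fun p => Y + s < p.1 ∧ (p.1 : ℝ) ≤ Y * (1 + η) ∧ Y + t < p.2 ∧
    (p.2 : ℝ) ≤ Y * (1 + η) ∧ P p with hI
  have hYη : Y ≤ Y * (1 + η) := by nlinarith
  have hY1 : 0 ≤ Y * (1 + η) := hY.trans hYη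
  -- slabs
  set A₀ := Ioc ⌊Y⌋₊ ⌊Y + s⌋₊ ×ˢ Ioc ⌊Y⌋₊ ⌊Y * (1 + η)⌋₊ with hA₀
  set B₀ := Ioc ⌊Y⌋₊ ⌊Y * (1 + η)⌋₊ ×ˢ Ioc ⌊Y⌋₊ ⌊Y + t⌋₊ with hB₀
  set A₁ := Ioc ⌊Y * (1 + η)⌋₊ ⌊Y * (1 + η) + s⌋₊ ×ˢ Ioc ⌊Y + t⌋₊ ⌊Y * (1 + η) + t⌋₊ with hA₁
  set B₁ := Ioc ⌊Y + s⌋₊ ⌊Y * (1 + η) + s⌋₊ ×ˢ Ioc ⌊Y * (1 + η)⌋₊ ⌊Y * (1 + η) + t⌋₊ with hB₁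
  have cA₀ : (#A₀ : ℝ) ≤ (s + 1) * (η * Y + 1) := by
    refine (card_slab_le hY (by linarith) hY hYη).trans (le_of_eq ?_); ring
  have cB₀ : (#B₀ : ℝ) ≤ (η * Y + 1) * (t + 1) := by
    refine (card_slab_le hY hYη hY (by linarith)).trans (le_of_eq ?_); ring
  have cA₁ : (#A₁ : ℝ) ≤ (s + 1) * (η * Y + 1) := by
    refine (card_slab_le hY1 (by linarith) (by linarith) (by linarith)).trans (le_of_eq ?_); ring
  have cB₁ : (#B₁ : ℝ) ≤ (η * Y + 1) * (t + 1) := by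
    refine (card_slab_le (by linarith) (by linarith) hY1 (by linarith)).trans (le_of_eq ?_); ring
  -- coverings
  have h0 : S₀ ⊆ I ∪ (A₀ ∪ B₀) := by
    intro p hp
    rw [hS₀, mem_filter] at hp
    obtain ⟨hU, h1, h2, h3, h4, hP⟩ := hp
    rw [mem_union, mem_union]
    by_cases hx : Y + s < p.1
    · by_cases hy : Y + t < p.2
      · exact Or.inl (by rw [hI, mem_filter]; exact ⟨hU, hx, h2, hy, h4, hP⟩)
      · push Not at hy
        exact Or.inr (Or.inr (mem_product.2 ⟨mem_Ioc_floor_of hY h1 h2, mem_Ioc_floor_of hY h3 hy⟩))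
    · push Not at hx
      exact Or.inr (Or.inl (mem_product.2 ⟨mem_Ioc_floor_of hY h1 hx, mem_Ioc_floor_of hY h3 h4⟩))
  have h1 : S₁ ⊆ I ∪ (A₁ ∪ B₁) := by
    intro p hp
    rw [hS₁, mem_filter] at hp
    obtain ⟨hU, h1, h2, h3, h4, hP⟩ := hp
    rw [mem_union, mem_union]
    by_cases hx : (p.1 : ℝ) ≤ Y * (1 + η)
    · by_cases hy : (p.2 : ℝ) ≤ Y * (1 + η)
      · exact Or.inl (by rw [hI, mem_filter]; exact ⟨hU, h1, hx, h3, hy, hP⟩)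
      · push Not at hy
        exact Or.inr (Or.inr (mem_product.2 ⟨mem_Ioc_floor_of (by linarith) h1 h2,
          mem_Ioc_floor_of hY1 hy h4⟩))
    · push Not at hx
      exact Or.inr (Or.inl (mem_product.2 ⟨mem_Ioc_floor_of hY1 hx h2,
        mem_Ioc_floor_of (by linarith) h3 h4⟩))
  have hI0 : I ⊆ S₀ := by
    intro p hp
    rw [hI, mem_filter] at hp
    obtain ⟨hU, h1, h2, h3, h4, hP⟩ := hp
    rw [hS₀, mem_filter]
    exact ⟨hU, by linarith, h2, by linarith, h4, hP⟩
  have hI1 : I ⊆ S₁ := by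
    intro p hp
    rw [hI, mem_filter] at hp
    obtain ⟨hU, h1, h2, h3, h4, hP⟩ := hp
    rw [hS₁, mem_filter]
    exact ⟨hU, h1, by linarith, h3, by linarith, hP⟩
  have e0 : (#S₀ : ℝ) ≤ #I + (#A₀ + #B₀) := by
    have := (card_le_card h0).trans ((card_union_le _ _).trans (Nat.add_le_add_left (card_union_le _ _) _))
    exact_mod_cast this
  have e1 : (#S₁ : ℝ) ≤ #I + (#A₁ + #B₁) := by
    have := (card_le_card h1).trans ((card_union_le _ _).trans (Nat.add_le_add_left (card_union_le _ _) _))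
    exact_mod_cast this
  have f0 : (#I : ℝ) ≤ #S₀ := by exact_mod_cast card_le_card hI0
  have f1 : (#I : ℝ) ≤ #S₁ := by exact_mod_cast card_le_card hI1
  have hηY : 0 ≤ η * Y + 1 := by positivity
  rw [abs_le]
  constructor <;> nlinarith

/-- **The crux's count is a real shift of the class count of Heath-Brown's frame**: for `X' ≥ 0`, `η ≥ 0`,
`d ≥ 1`, `|residueClassPrimeCount X' η d a b − classPrimeCount (dX') η d a b| ≤ (a + b + 2)(η·dX' + 1)`
(substitute `x = a + dx₁`, `y = b + dx₂`: the class box `(a + dX', a + dX'(1+η)] × (b + dX', b + dX'(1+η)]`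
against `(dX', dX'(1+η)]²`). [cite: HeathBrownMoroz2004, §1 (1.1)–(1.2)] -/
theorem abs_residueClassPrimeCount_sub_classPrimeCount_le {X' η : ℝ} (hX' : 0 ≤ X') (hη : 0 ≤ η) {d : ℕ}
    (hd : 1 ≤ d) (a b : ℕ) :
    |(residueClassPrimeCount X' η d a b : ℝ) - classPrimeCount (d * X') η d a b| ≤
      ((a : ℝ) + b + 2) * (η * (d * X') + 1) := by
  classical
  set Y : ℝ := d * X' with hY
  have hd0 : (0 : ℝ) < d := by exact_mod_cast hd
  have hY0 : 0 ≤ Y := by positivity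
  set N : ℕ := ⌊Y * (1 + η)⌋₊ + a + b with hN
  set U : Finset (ℕ × ℕ) := Iic N ×ˢ Iic N with hU
  let P : ℕ × ℕ → Prop := fun p => p.1 ≡ a [MOD d] ∧ p.2 ≡ b [MOD d] ∧ Nat.Coprime p.1 p.2 ∧
    (p.1 ^ 3 + 2 * p.2 ^ 3).Prime
  have hmemU : ∀ {p : ℕ × ℕ}, (p.1 : ℝ) ≤ Y * (1 + η) + a → (p.2 : ℝ) ≤ Y * (1 + η) + b → p ∈ U := by
    intro p h1 h2
    rw [hU, mem_product, mem_Iic, mem_Iic, hN]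
    have ha : (p.1 : ℝ) ≤ ⌊Y * (1 + η) + a⌋₊ := by exact_mod_cast (Nat.le_floor h1)
    have hb : (p.2 : ℝ) ≤ ⌊Y * (1 + η) + b⌋₊ := by exact_mod_cast (Nat.le_floor h2)
    rw [Nat.floor_add_natCast (by positivity)] at ha hb
    constructor
    · exact_mod_cast (show (p.1 : ℝ) ≤ ⌊Y * (1 + η)⌋₊ + a + b by push_cast at ha ⊢; linarith)
    · exact_mod_cast (show (p.2 : ℝ) ≤ ⌊Y * (1 + η)⌋₊ + a + b by push_cast at hb ⊢; linarith)
  -- the class count as a box count in `U`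
  have e0 : classPrimeCount Y η d a b =
      #(U.filter fun p => Y < p.1 ∧ (p.1 : ℝ) ≤ Y * (1 + η) ∧ Y < p.2 ∧ (p.2 : ℝ) ≤ Y * (1 + η) ∧ P p) := by
    rw [classPrimeCount_def]
    congr 1
    ext p
    simp only [mem_filter, mem_classPairs_iff, mem_boxPairs_iff, P]
    constructor
    · rintro ⟨⟨⟨h1, h2, h3, h4, hcop⟩, hma, hmb⟩, hpr⟩
      exact ⟨hmemU (by linarith) (by linarith), h1, h2, h3, h4, hma, hmb, hcop, hpr⟩
    · rintro ⟨-, h1, h2, h3, h4, hma, hmb, hcop, hpr⟩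
      exact ⟨⟨⟨h1, h2, h3, h4, hcop⟩, hma, hmb⟩, hpr⟩
  -- the crux's count as the shifted box count in `U`, through `(x₁, x₂) ↦ (a + dx₁, b + dx₂)`
  let φ : ℕ × ℕ ↪ ℕ × ℕ := ⟨fun q => (a + d * q.1, b + d * q.2), fun q q' h => by
    simp only [Prod.mk.injEq] at h
    have hd' : d ≠ 0 := by omega
    exact Prod.ext (Nat.eq_of_mul_eq_mul_left (Nat.pos_of_ne_zero hd') (by omega))
      (Nat.eq_of_mul_eq_mul_left (Nat.pos_of_ne_zero hd') (by omega))⟩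
  have e1 : residueClassPrimeCount X' η d a b =
      #(U.filter fun p => Y + a < p.1 ∧ (p.1 : ℝ) ≤ Y * (1 + η) + a ∧ Y + b < p.2 ∧
        (p.2 : ℝ) ≤ Y * (1 + η) + b ∧ P p) := by
    rw [residueClassPrimeCount_def, ← card_map φ]
    congr 1
    ext p
    rw [Finset.mem_map, mem_filter]
    constructor
    · rintro ⟨⟨x₁, x₂⟩, hq, rfl⟩
      obtain ⟨h1, h2, h3, h4, hcop, hpr⟩ := mem_residueClassPrimePairs_iff.1 hq
      simp only [φ, Function.Embedding.coeFn_mk, P]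
      have g1 : (((a + d * x₁ : ℕ) : ℝ)) = a + d * x₁ := by push_cast; ring
      have g2 : (((b + d * x₂ : ℕ) : ℝ)) = b + d * x₂ := by push_cast; ring
      refine ⟨hmemU ?_ ?_, ?_, ?_, ?_, ?_, ?_, ?_, hcop, hpr⟩
      · rw [g1, hY]; nlinarith
      · rw [g2, hY]; nlinarith
      · rw [g1, hY]; nlinarith
      · rw [g1, hY]; nlinarith
      · rw [g2, hY]; nlinarith
      · rw [g2, hY]; nlinarith
      · exact (Nat.modEq_iff_dvd' (Nat.le_add_right a _)).2 (by simp)  |>.symm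
      · exact (Nat.modEq_iff_dvd' (Nat.le_add_right b _)).2 (by simp)  |>.symm
    · rintro ⟨-, h1, h2, h3, h4, hma, hmb, hcop, hpr⟩
      have ha' : a ≤ p.1 := by
        have : (a : ℝ) < p.1 := by linarith
        exact_mod_cast this.le
      have hb' : b ≤ p.2 := by
        have : (b : ℝ) < p.2 := by linarith
        exact_mod_cast this.le
      obtain ⟨x₁, hx₁⟩ : d ∣ p.1 - a := (Nat.modEq_iff_dvd' ha').1 hma.symm
      obtain ⟨x₂, hx₂⟩ : d ∣ p.2 - b := (Nat.modEq_iff_dvd' hb').1 hmb.symm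
      have hp1 : p.1 = a + d * x₁ := by omega
      have hp2 : p.2 = b + d * x₂ := by omega
      refine ⟨(x₁, x₂), ?_, ?_⟩
      · apply mem_residueClassPrimePairs_iff.2
        have g1 : (p.1 : ℝ) = a + d * x₁ := by rw [hp1]; push_cast; ring
        have g2 : (p.2 : ℝ) = b + d * x₂ := by rw [hp2]; push_cast; ring
        rw [g1] at h1 h2; rw [g2] at h3 h4
        rw [← hp1, ← hp2]
        refine ⟨?_, ?_, ?_, ?_, hcop, hpr⟩
        · by_contra hc; push Not at hc; rw [hY] at h1; nlinarith
        · by_contra hc; push Not at hc; rw [hY] at h2; nlinarith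
        · by_contra hc; push Not at hc; rw [hY] at h3; nlinarith
        · by_contra hc; push Not at hc; rw [hY] at h4; nlinarith
      · simp only [φ, Function.Embedding.coeFn_mk, ← hp1, ← hp2]
  rw [e0, e1]
  exact card_box_shift_le U P hY0 hη (Nat.cast_nonneg a) (Nat.cast_nonneg b)

end Summit.Parity.GeneralizedHardyLittlewood.Theorems.GoldbachHeathBrownDispersionHeathBrownMorozUniform

end
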